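import Summits.QuantumFields.BalabanUV.T4Continuum.Support.NE7GradientCurrency
import Summits.QuantumFields.BalabanUV.T4Continuum.Support.NE7AxialChartCube
import HarnessLib

/-!
# NE7 — THE LOCAL ABSORPTION DEVICE: a distance-weighted interior bootstrap on a cube turns R37-type estimates with an a priori gradient
# term into a gradient bound WITHOUT `log`, and the local twin of (157): on a sup-cube of radius `R₀`, `‖A‖ ≤ ρ`, plaquette-divergence `J`,
# reaction-gradient `P`, `32(d+1)R₀(e^{4ρ} − 1) ≤ 1` ⟹ `‖∇A‖ ≤ (6ρ + 14(d+1)ρ + 2R₀²(J + P))∕D₀` at depth `D₀` (F299)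

Cell `pub-balaban`, rung (B)+1 sub-cell t4, lineage `b2b-balaban-t4-ne7-p1` (CRUX PROVER NE7 #1 = OWNER of row NE7), generation 92; memo
`t4/b2b-balaban-t4-ne7-p1-g92/LOG-OBSTRUCTION.md` §4 (ROAD (U): the first-order cube chart of [B11] Thm 1 (9) by a lattice Uhlenbeck argument on ONE
scale).  Over (156) `NE7LatticeHodgeGradient.norm_fdiff_le_of_curl_div` (R37 = `NE3DiscreteGradientEstimate.norm_sub_le_of_laplacian`, [Gilbarg–Trudinger
Thm 3.9] on `ℤᵈ`), (157) `NE7GradientCurrency.norm_plaqRem_sub_plaqRem_le` ∕ `hol_vary_flat_plaqWord`, and F290a's sup-distance lemmas.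

WHY.  (157) `NE7GradientCurrency.norm_fdiff_le_of_plaqDiv` bounds every forward difference of a bond field `A` (`W = e^{A}`, `‖A‖ ≤ ρ`) by
`2(dρ∕R + R(J + 4d(e^{4ρ} − 1)·G + P))` with `G` an A PRIORI bound on the same forward differences; lineage #2 absorbed `G` on a TORUS (the global maximum
exists), and every later use of the gradient currency was global.  Route 1's chart is LOCAL (F282w–F286w, F298: a cube of `M_c` blocks about a point), and on a
cube the maximum of `‖∇A‖` sits at the boundary where no estimate holds.  Iterating R37 shell by shell costs `log M` shells; the textbook cure ([Gilbarg–Trudinger]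
§4.3∕§6.1, interior norms weighted by the distance to the boundary) costs nothing: with `Φ = max_y δ(y)·‖∇A(y)‖` (`δ` = depth in the cube) the a priori term at
depth `D` is `≤ 2Φ∕D` on the half-depth cube, R37 at radius `≈ D∕2` returns `δ·‖∇A‖ ≤ 5a + R₀²b∕2 + R₀θ·Φ`, and `4R₀θ ≤ 1` absorbs.  Output: `‖∇A‖ ≤ Φ∕D₀` at
depth `D₀` — with `R₀ ≍ ℓM`, `ρ ≍ ℓt∕M`, `J ≍ t∕M³`, `D₀ = M`: `‖∇A‖ ≲ (ℓ + ℓ²)·t∕M²`, the printed gradient letter of (9), polynomial in `ℓ`, no logarithm.  This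
is the device that lets the cube chart's GRADIENT letter be derived from its SUP letter plus the current (F300), i.e. that reduces (CUBE) of F298 to a local
lattice-Landau gauge with the sup letter alone.
WHAT ([folklore]; 0 def, 0 sorry).  §1 cube bookkeeping (`mem_cube_iff`, sup-distance under a shift).  §2 **`weighted_bootstrap`** (abstract: any nonnegative
`g(y, κ, τ)` with a trivial bound `g₀` on the cube, and local estimates `g(y) ≤ a∕R + R(b + θ·G)` from a priori bounds `G` on the `(R+1)`-neighbourhood, `4R₀θ ≤ 1`
⟹ `g ≤ (3g₀ + 7a + R₀²b)∕D₀` at depth `D₀`).  §3 **`norm_fdiff_le_of_plaqDiv_local`** (the local twin of (157) §2: hypotheses on the sup-cube of radius `R + 1`).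
§4 **`norm_fdiff_le_of_plaqDiv_cube`**: `‖A(y + e_τ, κ) − A(y, κ)‖ ≤ (6ρ + 14(d+1)ρ + 2R₀²(J + P))∕D₀` for `|y − z|_∞ + D₀ ≤ R₀`, under `32(d+1)R₀(e^{4ρ} − 1) ≤ 1`.
HONEST FRAMING (page 1): elementary lattice analysis of OUR objects; `ρ`, `J`, `P` are HYPOTHESES (no gauge is constructed, no minimiser used); nothing of Bałaban's
asserted; NE7 NOT PROVED; spine 0∕9; finite T⁴ rung (B)+1 — NOT infinite volume, NOT mass gap, NOT `BetaPertH`, NOT Clay.  Continuum YM on T⁴ ⇐ BetaPertH ∧ nine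
spine estimates (0/9 proved); BetaPertH ⇐ (D1) ∧ (D4) ∧ CAP+tail; G-an2-4 gates asym, D1 and NE2/3/4.  No `sorry`; axioms ⊆ {propext, Classical.choice, Quot.sound}.
-/

set_option autoImplicit false

open scoped BigOperators Matrix Matrix.Norms.L2Operator
open NormedSpace Finset

namespace Summit.QuantumFields.BalabanUV.T4Continuum.NE7LocalGradientBootstrap

open Literature.MathematicalPhysics.QuantumFieldTheory.Balaban1983to89
open B7Prop1Explicit B7Prop2Explicit
open T4AveragingDeficitWall (vary)
open BlockAveragePushDirSplit (flat)
open NE7LatticeHodgeGradient (norm_fdiff_le_of_curl_div)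
open NE7GradientCurrency (norm_plaqRem_sub_plaqRem_le hol_vary_flat_plaqWord)
open NE7AxialChartCube (abs_sub_le_supDist supDist_step_le)

noncomputable section

variable {d : ℕ}

/-! ## §1 Cube bookkeeping -/

/-- Membership in the lattice box `Icc (z − w𝟙) (z + w𝟙)` is the sup-distance condition `|y − z|_∞ ≤ w`. [folklore] -/
theorem mem_cube_iff (z : Site (d + 1)) (w : ℤ) (y : Site (d + 1)) :
    y ∈ Finset.Icc (z - fun _ => w) (z + fun _ => w) ↔ ∀ i, |y i - z i| ≤ w := by
  rw [Finset.mem_Icc]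
  constructor
  · rintro ⟨h1, h2⟩ i
    have a := h1 i
    have b := h2 i
    simp only [Pi.sub_apply, Pi.add_apply] at a b
    rw [abs_le]; constructor <;> linarith
  · intro h
    constructor
    · intro i; have := (abs_le.mp (h i)).1; simp only [Pi.sub_apply]; linarith
    · intro i; have := (abs_le.mp (h i)).2; simp only [Pi.add_apply]; linarith

/-- The sup-distance is subadditive under a shift of sup-size `s`. [folklore] -/
theorem supDist_shift_le (z y y' : Site (d + 1)) (s : ℤ) (h : ∀ i, |y' i - y i| ≤ s) :
    Finset.univ.sup' Finset.univ_nonempty (fun j => |y' j - z j|) ≤ Finset.univ.sup' Finset.univ_nonempty (fun j => |y j - z j|) + s := by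
  refine Finset.sup'_le _ _ fun j _ => ?_
  have h1 := abs_sub_le_supDist z y j
  have h2 : |y' j - z j| ≤ |y' j - y j| + |y j - z j| := by
    rw [show y' j - z j = (y' j - y j) + (y j - z j) by ring]; exact abs_add_le _ _
  linarith [h j]

/-- The sup-distance is nonnegative. [folklore] -/
theorem supDist_nonneg (z y : Site (d + 1)) : 0 ≤ Finset.univ.sup' Finset.univ_nonempty (fun j => |y j - z j|) :=
  (abs_nonneg _).trans (abs_sub_le_supDist z y 0)

/-! ## §2 The distance-weighted interior bootstrap (abstract) -/

set_option maxHeartbeats 800000 in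
/-- **THE WEIGHTED INTERIOR BOOTSTRAP.**  Let `g(y, κ, τ) ≥ 0` on `ℤ^{d+1}`, a cube of radius `R₀ ≥ 1` about `z`, and letters `g₀, a, b ≥ 0`, `θ` with: (trivial bound)
`g(y, ·, ·) ≤ g₀` for `|y − z|_∞ ≤ R₀ − 1`; (local estimate) for every `y` and `R ≥ 1` with `|y − z|_∞ + 2R + 2 ≤ R₀` and every `G` bounding `g` on
`{|y′ − y|_∞ ≤ R + 1}`: `g(y, ·, ·) ≤ a∕R + R(b + θG)`; (absorption) `4R₀θ ≤ 1`.  THEN at depth `D₀ ≥ 1` (`|y − z|_∞ + D₀ ≤ R₀`): `g(y, κ, τ) ≤ (3g₀ + 7a + R₀²b)∕D₀`.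
(Maximise `δ(y)·g(y)` over the cube, `δ` the depth; at the maximiser use the local estimate at radius `⌊δ∕2⌋ − 1`.) [folklore] -/
theorem weighted_bootstrap (g : Site (d + 1) → Fin (d + 1) → Fin (d + 1) → ℝ) (z : Site (d + 1)) (R₀ : ℕ) (hR₀ : 1 ≤ R₀)
    {g₀ a b θ : ℝ} (hg₀ : 0 ≤ g₀) (ha : 0 ≤ a) (hb : 0 ≤ b)
    (hg : ∀ y κ τ, 0 ≤ g y κ τ)
    (htriv : ∀ (y : Site (d + 1)) (κ τ : Fin (d + 1)), (∀ i, |y i - z i| ≤ (R₀ : ℤ) - 1) → g y κ τ ≤ g₀)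
    (hloc : ∀ (y : Site (d + 1)) (R : ℕ), 1 ≤ R → (∀ i, |y i - z i| + (2 * R + 2 : ℕ) ≤ (R₀ : ℤ)) → ∀ G : ℝ,
      (∀ y' : Site (d + 1), (∀ i, |y' i - y i| ≤ (R : ℤ) + 1) → ∀ κ τ, g y' κ τ ≤ G) →
      ∀ κ τ, g y κ τ ≤ a / R + R * (b + θ * G))
    (hs : 4 * (R₀ : ℝ) * θ ≤ 1)
    (y : Site (d + 1)) (D₀ : ℕ) (hD₀ : 1 ≤ D₀) (hy : ∀ i, |y i - z i| + (D₀ : ℤ) ≤ (R₀ : ℤ)) (κ τ : Fin (d + 1)) :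
    g y κ τ ≤ (3 * g₀ + 7 * a + (R₀ : ℝ) ^ 2 * b) / D₀ := by
  -- the sup-distance and the finite set of sites of depth ≥ 1
  set Dist : Site (d + 1) → ℤ := fun p => Finset.univ.sup' Finset.univ_nonempty (fun j => |p j - z j|) with hDist
  have hDle : ∀ (p : Site (d + 1)) (c : ℤ), Dist p ≤ c → ∀ i, |p i - z i| ≤ c := fun p c h i => (abs_sub_le_supDist z p i).trans h
  have hDge : ∀ (p : Site (d + 1)) (c : ℤ), (∀ i, |p i - z i| ≤ c) → Dist p ≤ c := fun p c h => Finset.sup'_le _ _ fun j _ => h j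
  have hD0 : ∀ p, 0 ≤ Dist p := fun p => supDist_nonneg z p
  obtain ⟨S, hS⟩ : ∃ S : Finset (Site (d + 1)), S = Finset.Icc (z - fun _ => (R₀ : ℤ) - 1) (z + fun _ => (R₀ : ℤ) - 1) := ⟨_, rfl⟩
  have hmemS : ∀ p, p ∈ S ↔ Dist p ≤ (R₀ : ℤ) - 1 := fun p => by
    rw [hS, mem_cube_iff]; exact ⟨fun h => hDge p _ h, fun h => hDle p _ h⟩
  obtain ⟨T, hT⟩ : ∃ T : Finset (Site (d + 1) × (Fin (d + 1) × Fin (d + 1))),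
      T = S ×ˢ ((Finset.univ : Finset (Fin (d + 1))) ×ˢ (Finset.univ : Finset (Fin (d + 1)))) := ⟨_, rfl⟩
  have hmemT : ∀ (p : Site (d + 1)) (κ' τ' : Fin (d + 1)), p ∈ S → (p, (κ', τ')) ∈ T := fun p κ' τ' hp => by
    rw [hT]
    exact Finset.mem_product.mpr ⟨hp, Finset.mem_product.mpr ⟨Finset.mem_univ _, Finset.mem_univ _⟩⟩
  have hmemT' : ∀ t : Site (d + 1) × (Fin (d + 1) × Fin (d + 1)), t ∈ T → t.1 ∈ S := fun t ht => by
    rw [hT] at ht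
    exact (Finset.mem_product.mp ht).1
  obtain ⟨f, hf⟩ : ∃ f : Site (d + 1) × (Fin (d + 1) × Fin (d + 1)) → ℝ, f = fun t => ((R₀ : ℝ) - (Dist t.1 : ℝ)) * g t.1 t.2.1 t.2.2 :=
    ⟨_, rfl⟩
  -- `y` itself has depth ≥ D₀ ≥ 1
  have hyD : Dist y + (D₀ : ℤ) ≤ (R₀ : ℤ) := by
    have : Dist y ≤ (R₀ : ℤ) - D₀ := hDge y _ fun i => by linarith [hy i]
    linarith
  have hD₀1 : (1 : ℤ) ≤ D₀ := by exact_mod_cast hD₀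
  have hyS : y ∈ S := (hmemS y).mpr (by linarith)
  have hTne : T.Nonempty := ⟨(y, (κ, τ)), hmemT y κ τ hyS⟩
  -- the maximiser
  obtain ⟨m, hmT, hmax⟩ := Finset.exists_max_image T f hTne
  set Φ := f m with hΦ
  have hmS : m.1 ∈ S := hmemT' m hmT
  have hmD : Dist m.1 ≤ (R₀ : ℤ) - 1 := (hmemS _).mp hmS
  have hΦ0 : 0 ≤ Φ := by
    rw [hΦ, hf]
    simp only
    refine mul_nonneg ?_ (hg _ _ _)
    have : ((Dist m.1 : ℤ) : ℝ) ≤ (R₀ : ℝ) - 1 := by exact_mod_cast hmD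
    linarith
  -- every weighted value on `S` is at most `Φ`
  have hle : ∀ (p : Site (d + 1)) (κ' τ' : Fin (d + 1)), Dist p ≤ (R₀ : ℤ) - 1 → ((R₀ : ℝ) - (Dist p : ℝ)) * g p κ' τ' ≤ Φ := by
    intro p κ' τ' hp
    have h := hmax _ (hmemT p κ' τ' ((hmemS p).mpr hp))
    simpa only [hf] using h
  -- THE KEY BOUND `Φ ≤ 3g₀ + 7a + R₀²b`
  have hkey : Φ ≤ 3 * g₀ + 7 * a + (R₀ : ℝ) ^ 2 * b := by
    -- the depth of the maximiser as a natural number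
    obtain ⟨k, hk⟩ := Int.eq_ofNat_of_zero_le (show (0 : ℤ) ≤ (R₀ : ℤ) - Dist m.1 by linarith)
    have hk1 : 1 ≤ k := by have : (1 : ℤ) ≤ (k : ℤ) := by rw [← hk]; linarith
                           exact_mod_cast this
    have hkR : k ≤ R₀ := by have : (k : ℤ) ≤ (R₀ : ℤ) := by rw [← hk]; linarith [hD0 m.1]
                            exact_mod_cast this
    have hΦeq : Φ = (k : ℝ) * g m.1 m.2.1 m.2.2 := by
      rw [hΦ, hf]
      simp only
      congr 1
      have : ((R₀ : ℤ) : ℝ) - ((Dist m.1 : ℤ) : ℝ) = ((k : ℤ) : ℝ) := by exact_mod_cast hk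
      push_cast at this ⊢; linarith
    by_cases hk3 : k ≤ 3
    · -- shallow maximiser: the trivial bound
      have h1 : g m.1 m.2.1 m.2.2 ≤ g₀ := htriv _ _ _ (hDle _ _ hmD)
      have h2 : (k : ℝ) ≤ 3 := by exact_mod_cast hk3
      rw [hΦeq]
      nlinarith [hg m.1 m.2.1 m.2.2]
    · -- deep maximiser: the local estimate at radius `R = ⌊k∕2⌋ − 1`
      push Not at hk3
      set R : ℕ := k / 2 - 1 with hRdef
      have hR1 : 1 ≤ R := by omega
      have h2R : 2 * R + 2 ≤ k := by omega
      have hR2 : R + 2 ≤ k := by omega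
      have h5R : k ≤ 5 * R := by omega
      have h2Rk : 2 * R ≤ k := by omega
      have hhalf : (k : ℝ) ≤ 2 * ((k : ℝ) - R - 1) := by
        have h2 : (k : ℝ) ≤ 2 * (((k - (R + 1) : ℕ) : ℝ)) := by exact_mod_cast (by omega : k ≤ 2 * (k - (R + 1)))
        rw [Nat.cast_sub (by omega : R + 1 ≤ k)] at h2; push_cast at h2; linarith
      -- the hypotheses of `hloc` at `m.1` with radius `R` and `G = 2Φ∕k`
      have hdepth : ∀ i, |m.1 i - z i| + (2 * R + 2 : ℕ) ≤ (R₀ : ℤ) := fun i => by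
        have h1 := abs_sub_le_supDist z m.1 i
        have h2 : ((2 * R + 2 : ℕ) : ℤ) ≤ (k : ℤ) := by exact_mod_cast h2R
        change |m.1 i - z i| ≤ Dist m.1 at h1
        linarith
      have hkpos : (0 : ℝ) < k := by exact_mod_cast (by omega : 0 < k)
      have hG : ∀ y' : Site (d + 1), (∀ i, |y' i - m.1 i| ≤ (R : ℤ) + 1) → ∀ κ' τ', g y' κ' τ' ≤ 2 * Φ / k := by
        intro y' hy' κ' τ'
        have hd1 : Dist y' ≤ Dist m.1 + ((R : ℤ) + 1) := supDist_shift_le z m.1 y' _ hy'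
        have hd2 : Dist y' ≤ (R₀ : ℤ) - 1 := by
          have : ((R + 2 : ℕ) : ℤ) ≤ (k : ℤ) := by exact_mod_cast hR2
          push_cast at this; linarith
        have h3 := hle y' κ' τ' hd2
        -- the depth of `y'` is at least `k − R − 1 ≥ k∕2`
        have hd3 : (k : ℝ) - R - 1 ≤ (R₀ : ℝ) - (Dist y' : ℝ) := by
          have : ((Dist y' : ℤ) : ℝ) ≤ ((Dist m.1 : ℤ) : ℝ) + ((R : ℝ) + 1) := by exact_mod_cast hd1
          have e : ((R₀ : ℤ) : ℝ) - ((Dist m.1 : ℤ) : ℝ) = ((k : ℤ) : ℝ) := by exact_mod_cast hk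
          push_cast at e this ⊢; linarith
        have hpos : 0 < (R₀ : ℝ) - (Dist y' : ℝ) := by
          have : (k : ℝ) - R - 1 ≥ 1 := by
            have : ((R + 2 : ℕ) : ℝ) ≤ (k : ℝ) := by exact_mod_cast hR2
            push_cast at this; linarith
          linarith
        rw [le_div_iff₀ hkpos]
        have hgy := hg y' κ' τ'
        calc g y' κ' τ' * k ≤ g y' κ' τ' * (2 * ((R₀ : ℝ) - (Dist y' : ℝ))) := by
              apply mul_le_mul_of_nonneg_left _ hgy; linarith
          _ = 2 * (((R₀ : ℝ) - (Dist y' : ℝ)) * g y' κ' τ') := by ring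
          _ ≤ 2 * Φ := by linarith
      have hest := hloc m.1 R hR1 hdepth (2 * Φ / k) hG m.2.1 m.2.2
      -- assemble: `Φ = k·g ≤ a·k∕R + kR·b + 2Rθ·Φ ≤ 5a + R₀²b∕2 + Φ∕4`
      have hRpos : (0 : ℝ) < R := by exact_mod_cast (by omega : 0 < R)
      have hkR' : (k : ℝ) ≤ 5 * R := by exact_mod_cast h5R
      have h2R' : 2 * (R : ℝ) ≤ k := by exact_mod_cast h2Rk
      have hkR₀ : (k : ℝ) ≤ R₀ := by exact_mod_cast hkR
      have e1 : (k : ℝ) * (a / R + R * (b + θ * (2 * Φ / k))) = a * (k / R) + (k * R) * b + 2 * R * θ * Φ := by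
        field_simp
        ring
      have t1 : a * ((k : ℝ) / R) ≤ 5 * a := by nlinarith [(by rw [div_le_iff₀ hRpos]; linarith : (k : ℝ) / R ≤ 5)]
      have t2 : ((k : ℝ) * R) * b ≤ (R₀ : ℝ) ^ 2 / 2 * b := by
        have : (k : ℝ) * R ≤ (R₀ : ℝ) ^ 2 / 2 := by nlinarith
        nlinarith
      have t3 : 2 * (R : ℝ) * θ * Φ ≤ Φ / 4 := by nlinarith [(by nlinarith : 2 * (R : ℝ) * θ ≤ 1 / 4)]
      have hmain : Φ ≤ 5 * a + (R₀ : ℝ) ^ 2 / 2 * b + Φ / 4 := by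
        calc Φ = (k : ℝ) * g m.1 m.2.1 m.2.2 := hΦeq
          _ ≤ (k : ℝ) * (a / R + R * (b + θ * (2 * Φ / k))) := mul_le_mul_of_nonneg_left hest hkpos.le
          _ = a * (k / R) + (k * R) * b + 2 * R * θ * Φ := e1
          _ ≤ 5 * a + (R₀ : ℝ) ^ 2 / 2 * b + Φ / 4 := by linarith
      nlinarith [mul_nonneg (sq_nonneg (R₀ : ℝ)) hb]
  -- conclusion at `y`
  have h1 := hle y κ τ ((hmemS y).mp hyS)
  have hD₀pos : (0 : ℝ) < D₀ := by exact_mod_cast (by omega : 0 < D₀)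
  have h2 : (D₀ : ℝ) ≤ (R₀ : ℝ) - (Dist y : ℝ) := by
    have : ((Dist y : ℤ) : ℝ) + (D₀ : ℝ) ≤ (R₀ : ℝ) := by exact_mod_cast hyD
    linarith
  rw [le_div_iff₀ hD₀pos]
  calc g y κ τ * D₀ ≤ g y κ τ * ((R₀ : ℝ) - (Dist y : ℝ)) := mul_le_mul_of_nonneg_left h2 (hg y κ τ)
    _ = ((R₀ : ℝ) - (Dist y : ℝ)) * g y κ τ := by ring
    _ ≤ Φ := h1
    _ ≤ _ := hkey

/-! ## §3 The local twin of (157) §2 -/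

section Carriers

variable {n : Type*} [Fintype n] [DecidableEq n] [Nonempty n]

set_option maxHeartbeats 800000 in
/-- **THE GRADIENT OF `A` FROM THE PLAQUETTE DIVERGENCE OF `e^{A}`, LOCALLY, WITH AN A PRIORI GRADIENT BOUND** — (157)
`NE7GradientCurrency.norm_fdiff_le_of_plaqDiv` with every hypothesis restricted to a sup-cube about `x`: `‖A‖ ≤ ρ` and the a priori bound `G` on the forward
differences on the sup-cube of radius `R + 1`, the plaquette-divergence bound `J` (for `W = e^{A}`) and the divergence-gradient bound `P` on the sup-cube of radius `R`
⟹ `‖A(x+e_τ)_κ − A(x)_κ‖ ≤ 2·(d·ρ∕R + R·(J + 4d(e^{4ρ} − 1)G + P))` (`d` = the dimension `d+1` here). [folklore] -/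
theorem norm_fdiff_le_of_plaqDiv_local (A : Site (d + 1) → Fin (d + 1) → Matrix n n ℂ) (x : Site (d + 1)) {R : ℕ} (hR : 1 ≤ R) {ρ G J P : ℝ}
    (hA : ∀ (y : Site (d + 1)) (κ : Fin (d + 1)), (∀ i, |y i - x i| ≤ (R : ℤ) + 1) → ‖A y κ‖ ≤ ρ)
    (hG : ∀ (y : Site (d + 1)) (κ τ : Fin (d + 1)), (∀ i, |y i - x i| ≤ (R : ℤ) + 1) → ‖A (y + e τ) κ - A y κ‖ ≤ G)
    (hJ : ∀ (y : Site (d + 1)) (ν : Fin (d + 1)), (∀ i, |y i - x i| ≤ (R : ℤ)) →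
      ‖∑ μ, ((((hol (vary (flat (d := d + 1) (n := n)) A 1) y (plaqWord μ ν) : (Matrix n n ℂ)ˣ) : Matrix n n ℂ) - 1)
              - (((hol (vary (flat (d := d + 1) (n := n)) A 1) (y - e μ) (plaqWord μ ν) : (Matrix n n ℂ)ˣ) : Matrix n n ℂ) - 1))‖ ≤ J)
    (hP : ∀ (y : Site (d + 1)) (ν : Fin (d + 1)), (∀ i, |y i - x i| ≤ (R : ℤ)) →
      ‖∑ μ, (A (y + e ν) μ - A (y + e ν - e μ) μ) - ∑ μ, (A y μ - A (y - e μ) μ)‖ ≤ P)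
    (ν τ : Fin (d + 1)) :
    ‖A (x + e τ) ν - A x ν‖ ≤ 2 * ((((d + 1 : ℕ) : ℝ)) * ρ / R + R * ((J + 4 * ((d + 1 : ℕ) : ℝ) * (Real.exp (4 * ρ) - 1) * G) + P)) := by
  refine norm_fdiff_le_of_curl_div (E := Matrix n n ℂ) A x ν τ hR (fun y hy => hA y ν (fun i => (hy i).trans (by linarith))) (fun y hy => ?_)
    (fun y hy => hP y ν hy)
  -- points of the stencil at `y` lie in the cube of radius `R + 1`
  have near : ∀ (w : Site (d + 1)), (∀ i, |w i - y i| ≤ 1) → ∀ i, |w i - x i| ≤ (R : ℤ) + 1 := fun w hw i => by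
    have h1 : |w i - x i| ≤ |w i - y i| + |y i - x i| := by
      rw [show w i - x i = (w i - y i) + (y i - x i) by ring]; exact abs_add_le _ _
    linarith [hw i, hy i]
  have e1 : ∀ (a : Fin (d + 1)) (i : Fin (d + 1)), |(e a : Site (d + 1)) i| ≤ 1 := fun a i => by rw [e_apply]; split_ifs <;> simp
  have ny : ∀ i, |y i - x i| ≤ (R : ℤ) + 1 := fun i => (hy i).trans (by linarith)
  have nyp : ∀ (a : Fin (d + 1)), ∀ i, |(y + e a) i - x i| ≤ (R : ℤ) + 1 := fun a => near _ fun i => by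
    rw [show (y + e a) i - y i = (e a : Site (d + 1)) i by simp]; exact e1 a i
  have nym : ∀ (a : Fin (d + 1)), ∀ i, |(y - e a) i - x i| ≤ (R : ℤ) + 1 := fun a => near _ fun i => by
    rw [show (y - e a) i - y i = -(e a : Site (d + 1)) i by simp, abs_neg]; exact e1 a i
  have nymp : ∀ (a b : Fin (d + 1)), ∀ i, |(y - e a + e b) i - x i| ≤ (R : ℤ) + 1 := fun a b => near _ fun i => by
    rw [show (y - e a + e b) i - y i = (e b : Site (d + 1)) i - (e a : Site (d + 1)) i by simp; ring]
    rw [e_apply, e_apply]; split_ifs <;> simp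
  -- the curl as plaquette deviation minus remainder
  set W := vary (flat (d := d + 1) (n := n)) A 1 with hW
  have hrem : ∀ (w : Site (d + 1)) (μ : Fin (d + 1)),
      (A w μ + A (w + e μ) ν - A (w + e ν) μ - A w ν)
        = (((hol W w (plaqWord μ ν) : (Matrix n n ℂ)ˣ) : Matrix n n ℂ) - 1)
          - (exp (A w μ) * exp (A (w + e μ) ν) * exp (-A (w + e ν) μ) * exp (-A w ν) - 1
              - (A w μ + A (w + e μ) ν + -A (w + e ν) μ + -A w ν)) := by
    intro w μ
    rw [hW, hol_vary_flat_plaqWord]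
    abel
  have hG0 : 0 ≤ G := (norm_nonneg _).trans (hG y ν ν ny)
  -- the remainder difference, summand by summand
  have hdiff : ∀ μ : Fin (d + 1),
      ‖(exp (A y μ) * exp (A (y + e μ) ν) * exp (-A (y + e ν) μ) * exp (-A y ν) - 1
            - (A y μ + A (y + e μ) ν + -A (y + e ν) μ + -A y ν))
        - (exp (A (y - e μ) μ) * exp (A (y - e μ + e μ) ν) * exp (-A (y - e μ + e ν) μ) * exp (-A (y - e μ) ν) - 1
            - (A (y - e μ) μ + A (y - e μ + e μ) ν + -A (y - e μ + e ν) μ + -A (y - e μ) ν))‖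
        ≤ (Real.exp (4 * ρ) - 1) * (4 * G) := by
    intro μ
    have h := norm_plaqRem_sub_plaqRem_le (hA y μ ny) (hA (y + e μ) ν (nyp μ)) (by rw [norm_neg]; exact hA (y + e ν) μ (nyp ν))
      (by rw [norm_neg]; exact hA y ν ny) (hA (y - e μ) μ (nym μ)) (hA (y - e μ + e μ) ν (nymp μ μ))
      (by rw [norm_neg]; exact hA (y - e μ + e ν) μ (nymp μ ν)) (by rw [norm_neg]; exact hA (y - e μ) ν (nym μ))
    refine h.trans (mul_le_mul_of_nonneg_left ?_ ?_)
    · have h1 : ‖A y μ - A (y - e μ) μ‖ ≤ G := by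
        have := hG (y - e μ) μ μ (nym μ); rwa [sub_add_cancel] at this
      have h2 : ‖A (y + e μ) ν - A (y - e μ + e μ) ν‖ ≤ G := by
        have := hG (y - e μ + e μ) ν μ (nymp μ μ)
        simp only [sub_add_cancel] at this ⊢
        exact hG y ν μ ny
      have h3 : ‖-A (y + e ν) μ - -A (y - e μ + e ν) μ‖ ≤ G := by
        have := hG (y - e μ + e ν) μ μ (nymp μ ν)
        rw [show y - e μ + e ν + e μ = y + e ν by abel] at this
        rw [show -A (y + e ν) μ - -A (y - e μ + e ν) μ = -(A (y + e ν) μ - A (y - e μ + e ν) μ) by abel, norm_neg]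
        exact this
      have h4 : ‖-A y ν - -A (y - e μ) ν‖ ≤ G := by
        have := hG (y - e μ) ν μ (nym μ)
        rw [sub_add_cancel] at this
        rw [show -A y ν - -A (y - e μ) ν = -(A y ν - A (y - e μ) ν) by abel, norm_neg]
        exact this
      linarith
    · have hρ0 : 0 ≤ ρ := (norm_nonneg _).trans (hA y ν ny)
      have := Real.one_le_exp (by positivity : 0 ≤ 4 * ρ)
      linarith
  -- assemble
  have hsplit : ∑ μ, ((A y μ + A (y + e μ) ν - A (y + e ν) μ - A y ν)
        - (A (y - e μ) μ + A (y - e μ + e μ) ν - A (y - e μ + e ν) μ - A (y - e μ) ν))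
      = ∑ μ, ((((hol W y (plaqWord μ ν) : (Matrix n n ℂ)ˣ) : Matrix n n ℂ) - 1) - (((hol W (y - e μ) (plaqWord μ ν) : (Matrix n n ℂ)ˣ) : Matrix n n ℂ) - 1))
        - ∑ μ, ((exp (A y μ) * exp (A (y + e μ) ν) * exp (-A (y + e ν) μ) * exp (-A y ν) - 1
            - (A y μ + A (y + e μ) ν + -A (y + e ν) μ + -A y ν))
          - (exp (A (y - e μ) μ) * exp (A (y - e μ + e μ) ν) * exp (-A (y - e μ + e ν) μ) * exp (-A (y - e μ) ν) - 1
            - (A (y - e μ) μ + A (y - e μ + e μ) ν + -A (y - e μ + e ν) μ + -A (y - e μ) ν))) := by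
    rw [← Finset.sum_sub_distrib]
    refine Finset.sum_congr rfl fun μ _ => ?_
    rw [hrem y μ, hrem (y - e μ) μ]
    abel
  rw [hsplit]
  refine (norm_sub_le _ _).trans ?_
  have hsum : ‖∑ μ : Fin (d + 1), ((exp (A y μ) * exp (A (y + e μ) ν) * exp (-A (y + e ν) μ) * exp (-A y ν) - 1
            - (A y μ + A (y + e μ) ν + -A (y + e ν) μ + -A y ν))
          - (exp (A (y - e μ) μ) * exp (A (y - e μ + e μ) ν) * exp (-A (y - e μ + e ν) μ) * exp (-A (y - e μ) ν) - 1
            - (A (y - e μ) μ + A (y - e μ + e μ) ν + -A (y - e μ + e ν) μ + -A (y - e μ) ν)))‖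
      ≤ 4 * ((d + 1 : ℕ) : ℝ) * (Real.exp (4 * ρ) - 1) * G := by
    refine (norm_sum_le _ _).trans ?_
    calc _ ≤ ∑ _μ : Fin (d + 1), (Real.exp (4 * ρ) - 1) * (4 * G) := Finset.sum_le_sum fun μ _ => hdiff μ
      _ = 4 * ((d + 1 : ℕ) : ℝ) * (Real.exp (4 * ρ) - 1) * G := by
          rw [Finset.sum_const, Finset.card_univ, Fintype.card_fin, nsmul_eq_mul]; ring
  exact add_le_add (hJ y ν hy) hsum

/-! ## §4 The gradient letter on a cube from the sup letter, the plaquette divergence and the reaction gradient -/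

set_option maxHeartbeats 800000 in
/-- **THE GRADIENT LETTER ON A CUBE, WITHOUT LOGARITHM.**  For `A : ℤ^{d+1} → (Fin (d+1) → Matrix n n ℂ)` and a sup-cube of radius `R₀ ≥ 1` about `z` on which `‖A‖ ≤ ρ`, the
plaquette divergence of `W = e^{A}` is `≤ J` and the divergence gradient is `≤ P` (the shapes of (157)), under the absorption condition `32(d+1)R₀(e^{4ρ} − 1) ≤ 1`:
at every `y` of depth `D₀ ≥ 1` (`|y − z|_∞ + D₀ ≤ R₀`), `‖A(y + e_τ, κ) − A(y, κ)‖ ≤ (6ρ + 14(d+1)ρ + 2R₀²(J + P))∕D₀` (§2 over §3). [folklore] -/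
theorem norm_fdiff_le_of_plaqDiv_cube (A : Site (d + 1) → Fin (d + 1) → Matrix n n ℂ) (z : Site (d + 1)) (R₀ : ℕ) (hR₀ : 1 ≤ R₀) {ρ J P : ℝ}
    (hρ : 0 ≤ ρ) (hJ0 : 0 ≤ J) (hP0 : 0 ≤ P)
    (hA : ∀ (y : Site (d + 1)) (κ : Fin (d + 1)), (∀ i, |y i - z i| ≤ (R₀ : ℤ)) → ‖A y κ‖ ≤ ρ)
    (hJ : ∀ (y : Site (d + 1)) (ν : Fin (d + 1)), (∀ i, |y i - z i| ≤ (R₀ : ℤ)) →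
      ‖∑ μ, ((((hol (vary (flat (d := d + 1) (n := n)) A 1) y (plaqWord μ ν) : (Matrix n n ℂ)ˣ) : Matrix n n ℂ) - 1)
              - (((hol (vary (flat (d := d + 1) (n := n)) A 1) (y - e μ) (plaqWord μ ν) : (Matrix n n ℂ)ˣ) : Matrix n n ℂ) - 1))‖ ≤ J)
    (hP : ∀ (y : Site (d + 1)) (ν : Fin (d + 1)), (∀ i, |y i - z i| ≤ (R₀ : ℤ)) →
      ‖∑ μ, (A (y + e ν) μ - A (y + e ν - e μ) μ) - ∑ μ, (A y μ - A (y - e μ) μ)‖ ≤ P)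
    (hs : 32 * ((d + 1 : ℕ) : ℝ) * R₀ * (Real.exp (4 * ρ) - 1) ≤ 1)
    (y : Site (d + 1)) (D₀ : ℕ) (hD₀ : 1 ≤ D₀) (hy : ∀ i, |y i - z i| + (D₀ : ℤ) ≤ (R₀ : ℤ)) (κ τ : Fin (d + 1)) :
    ‖A (y + e τ) κ - A y κ‖ ≤ (6 * ρ + 14 * ((d + 1 : ℕ) : ℝ) * ρ + 2 * (R₀ : ℝ) ^ 2 * (J + P)) / D₀ := by
  have hexp : 0 ≤ Real.exp (4 * ρ) - 1 := by linarith [Real.one_le_exp (by positivity : 0 ≤ 4 * ρ)]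
  have e1 : ∀ (a : Fin (d + 1)) (i : Fin (d + 1)), |(e a : Site (d + 1)) i| ≤ 1 := fun a i => by rw [e_apply]; split_ifs <;> simp
  have h := weighted_bootstrap (fun w κ' τ' => ‖A (w + e τ') κ' - A w κ'‖) z R₀ hR₀ (g₀ := 2 * ρ) (a := 2 * ((d + 1 : ℕ) : ℝ) * ρ)
    (b := 2 * (J + P)) (θ := 2 * (4 * ((d + 1 : ℕ) : ℝ) * (Real.exp (4 * ρ) - 1))) (by positivity) (by positivity) (by positivity)
    (fun _ _ _ => norm_nonneg _) ?_ ?_ ?_ y D₀ hD₀ hy κ τ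
  · refine h.trans (le_of_eq ?_)
    ring
  · -- the trivial bound `2ρ` at depth ≥ 1
    intro w κ' τ' hw
    have h1 : ‖A w κ'‖ ≤ ρ := hA w κ' fun i => (hw i).trans (by linarith)
    have h2 : ‖A (w + e τ') κ'‖ ≤ ρ := hA _ κ' fun i => by
      have : |(w + e τ') i - z i| ≤ |(e τ' : Site (d + 1)) i| + |w i - z i| := by
        rw [show (w + e τ') i - z i = (e τ' : Site (d + 1)) i + (w i - z i) by simp; ring]; exact abs_add_le _ _
      linarith [e1 τ' i, hw i]
    calc ‖A (w + e τ') κ' - A w κ'‖ ≤ ‖A (w + e τ') κ'‖ + ‖A w κ'‖ := norm_sub_le _ _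
      _ ≤ 2 * ρ := by linarith
  · -- the local estimate: §3 at radius `R` about `w`
    intro w R hR hw G hG κ' τ'
    have hin : ∀ (w' : Site (d + 1)), (∀ i, |w' i - w i| ≤ (R : ℤ) + 1) → ∀ i, |w' i - z i| ≤ (R₀ : ℤ) := fun w' hw' i => by
      have h1 : |w' i - z i| ≤ |w' i - w i| + |w i - z i| := by
        rw [show w' i - z i = (w' i - w i) + (w i - z i) by ring]; exact abs_add_le _ _
      have h2 := hw i
      push_cast at h2
      linarith [hw' i]
    have hin' : ∀ (w' : Site (d + 1)), (∀ i, |w' i - w i| ≤ (R : ℤ)) → ∀ i, |w' i - z i| ≤ (R₀ : ℤ) :=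
      fun w' hw' => hin w' fun i => (hw' i).trans (by linarith)
    have hl := norm_fdiff_le_of_plaqDiv_local (n := n) A w hR (ρ := ρ) (G := G) (J := J) (P := P)
      (fun w' κ'' hw' => hA w' κ'' (hin w' hw')) (fun w' κ'' τ'' hw' => hG w' hw' κ'' τ'') (fun w' ν hw' => hJ w' ν (hin' w' hw'))
      (fun w' ν hw' => hP w' ν (hin' w' hw')) κ' τ'
    refine hl.trans (le_of_eq ?_)
    field_simp
    ring
  · -- absorption
    nlinarith

end Carriers

end

end Summit.QuantumFields.BalabanUV.T4Continuum.NE7LocalGradientBootstrap
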